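import Summits.AtomisticToContinuum.Crystallization.Theorems.ChessboardParticlePlanesPeriodicWindowsStubOffsetLayerDecay

/-!
# Crux `PeriodicWindows` (stmt-AtomisticToContinuum-3240), line `dense-laminar-hull` — stub HC, helper
# `hc_farOfNotHollow`: the two hollow classes of the triangular lattice are uniformly discrete

For `a > 0` the hollow classes are `{s b + i v₁ + j v₂ : s = ±1, i, j ∈ ℤ}` with `b = barlowOffset a = (a/2, a√3/6, 0)`,
`v₁ = triangularVec₁ a = (a, 0, 0)`, `v₂ = triangularVec₂ a = (a/2, a√3/2, 0)`. If a horizontal `θ` is NOT a class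
point, then it is quantitatively far from the classes: `∃ η > 0`, `2η ≤ ‖θ - (s b + i v₁ + j v₂)‖` for all `s = ±1`,
`i, j ∈ ℤ` (`hc_farOfNotHollow`, the far-offset input of `hc_badOffsetSyndetic`).

Route: the class points within distance `1` of `θ` have coefficients in an explicit box (`hfo_box`: the first two
coordinates of `θ - (s b + i v₁ + j v₂)` are at most `1` in absolute value, whence `|i|, |j| ≤ 2(1 + |θ₀| + |θ₁|)/a + 1`,
`hfo_coeff_i`, `hfo_coeff_j`), so they form a finite set; each is at positive distance from `θ`; the minimum of these
finitely many positive distances and `1` is the separation (`hfo_exists_sep`). Folklore lattice discreteness.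
[folklore]
-/

noncomputable section

namespace Summit.AtomisticToContinuum.Crystallization.Theorems.PeriodicWindowsDenseLaminarHull

open Literature.MathematicalPhysics.StatisticalMechanics Filter Metric
open scoped BigOperators

/-! ## An abstract separation lemma -/

/-- **Separation from finitely many near points.** If `f > 0` on `Q` and the sublevel set `{x ∈ Q : f x ≤ 1}` is
finite, then `f` is bounded below on `Q` by some `2η > 0` (the minimum of the finitely many values `≤ 1` and of `1`).
[folklore] -/
theorem hfo_exists_sep {ι : Type*} (Q : Set ι) (f : ι → ℝ) (hpos : ∀ x ∈ Q, 0 < f x)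
    (hfin : {x | x ∈ Q ∧ f x ≤ 1}.Finite) : ∃ η : ℝ, 0 < η ∧ ∀ x ∈ Q, 2 * η ≤ f x := by
  by_cases hne : {x | x ∈ Q ∧ f x ≤ 1}.Nonempty
  · obtain ⟨x₀, hx₀, hmin⟩ := Set.exists_min_image _ f hfin hne
    refine ⟨min (f x₀) 1 / 2, half_pos (lt_min (hpos x₀ hx₀.1) one_pos), fun x hx => ?_⟩
    by_cases hle : f x ≤ 1
    · calc 2 * (min (f x₀) 1 / 2) = min (f x₀) 1 := by ring
        _ ≤ f x₀ := min_le_left _ _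
        _ ≤ f x := hmin x ⟨hx, hle⟩
    · calc 2 * (min (f x₀) 1 / 2) = min (f x₀) 1 := by ring
        _ ≤ 1 := min_le_right _ _
        _ ≤ f x := (not_le.1 hle).le
  · refine ⟨1 / 2, by norm_num, fun x hx => ?_⟩
    by_contra hlt
    exact hne ⟨x, hx, by linarith [not_le.1 hlt]⟩

/-! ## Coefficient bounds for near class points -/

/-- **The `j`-coefficient of a near class point is bounded**: from `|θ₁ - (s a t/6 + j a t/2)| ≤ 1` (`s = ±1`,
`1 ≤ t ≤ 3`, `a > 0`) follows `|j| a ≤ 2 + 2|θ₁| + a`. [folklore] -/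
theorem hfo_coeff_j {a t θ₁ s j : ℝ} (ha : 0 < a) (ht1 : 1 ≤ t) (ht3 : t ≤ 3) (hs : s = 1 ∨ s = -1)
    (h : |θ₁ - (s * (a * t / 6) + j * (a * t / 2))| ≤ 1) : |j| * a ≤ 2 + 2 * |θ₁| + a := by
  rw [abs_le] at h
  obtain ⟨hl, hu⟩ := h
  have hθl := neg_abs_le θ₁
  have hθu := le_abs_self θ₁
  have hat : 0 < a * t := by positivity
  have key : |j * (a * t)| ≤ 2 + 2 * |θ₁| + a * t / 3 := by
    rw [abs_le]
    rcases hs with rfl | rfl <;> constructor <;> linarith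
  rw [abs_mul, abs_of_pos hat] at key
  have h1 : |j| * a ≤ |j| * (a * t) :=
    calc |j| * a = |j| * a * 1 := by ring
      _ ≤ |j| * a * t := mul_le_mul_of_nonneg_left ht1 (by positivity)
      _ = |j| * (a * t) := by ring
  have h2 : a * t ≤ a * 3 := mul_le_mul_of_nonneg_left ht3 ha.le
  linarith

/-- **The `i`-coefficient of a near class point is bounded**: from `|θ₀ - (s a/2 + i a + j a/2)| ≤ 1` (`s = ±1`,
`a > 0`) follows `|i| a ≤ 1 + |θ₀| + a/2 + |j| a/2`. [folklore] -/
theorem hfo_coeff_i {a θ₀ s i j : ℝ} (ha : 0 < a) (hs : s = 1 ∨ s = -1)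
    (h : |θ₀ - (s * (a / 2) + i * a + j * (a / 2))| ≤ 1) : |i| * a ≤ 1 + |θ₀| + a / 2 + |j| * a / 2 := by
  rw [abs_le] at h
  obtain ⟨hl, hu⟩ := h
  have hθl := neg_abs_le θ₀
  have hθu := le_abs_self θ₀
  have hja : |j * a| = |j| * a := by rw [abs_mul, abs_of_pos ha]
  have hjl : -(|j| * a) ≤ j * a := by rw [← hja]; exact neg_abs_le _
  have hju : j * a ≤ |j| * a := by rw [← hja]; exact le_abs_self _
  have key : |i * a| ≤ 1 + |θ₀| + a / 2 + |j| * a / 2 := by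
    rw [abs_le]
    rcases hs with rfl | rfl <;> constructor <;> linarith
  rwa [abs_mul, abs_of_pos ha] at key

/-! ## Coordinates of the difference to a class point -/

/-- The first two coordinates of `θ - (s b + i v₁ + j v₂)`. [folklore] -/
theorem hfo_coord (a : ℝ) (θ : EuclideanSpace ℝ (Fin 3)) (s i j : ℝ) :
    (θ - (s • barlowOffset a + i • triangularVec₁ a + j • triangularVec₂ a)) 0 =
        θ 0 - (s * (a / 2) + i * a + j * (a / 2)) ∧
      (θ - (s • barlowOffset a + i • triangularVec₁ a + j • triangularVec₂ a)) 1 =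
        θ 1 - (s * (a * √3 / 6) + j * (a * √3 / 2)) := by
  constructor
  · simp [barlowOffset, triangularVec₁, triangularVec₂]
  · simp [barlowOffset, triangularVec₁, triangularVec₂]

/-- The squares of the first two coordinates of a vector of `ℝ³` are at most its squared norm. [folklore] -/
theorem hfo_sq_apply_le (x : EuclideanSpace ℝ (Fin 3)) : (x 0) ^ 2 ≤ ‖x‖ ^ 2 ∧ (x 1) ^ 2 ≤ ‖x‖ ^ 2 := by
  rw [gsc_norm_sq_eq]
  constructor <;> nlinarith [sq_nonneg (x 0), sq_nonneg (x 1), sq_nonneg (x 2)]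

/-- **Near class points have coefficients in a box**: if `‖θ - (s b + i v₁ + j v₂)‖ ≤ 1` with `s = ±1`, `a > 0`, then
`|i|, |j| ≤ ⌈2 (1 + |θ₀| + |θ₁|)/a⌉ + 1`. [folklore] -/
theorem hfo_box {a : ℝ} (ha : 0 < a) (θ : EuclideanSpace ℝ (Fin 3)) {s i j : ℤ} (hs : s = 1 ∨ s = -1)
    (h : ‖θ - ((s : ℝ) • barlowOffset a + (i : ℝ) • triangularVec₁ a + (j : ℝ) • triangularVec₂ a)‖ ≤ 1) :
    |i| ≤ ⌈2 * (1 + |θ 0| + |θ 1|) / a⌉ + 1 ∧ |j| ≤ ⌈2 * (1 + |θ 0| + |θ 1|) / a⌉ + 1 := by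
  set d := θ - ((s : ℝ) • barlowOffset a + (i : ℝ) • triangularVec₁ a + (j : ℝ) • triangularVec₂ a)
  have hsq : ‖d‖ ^ 2 ≤ 1 := by nlinarith [norm_nonneg d]
  obtain ⟨hc0, hc1⟩ := hfo_coord a θ (s : ℝ) (i : ℝ) (j : ℝ)
  obtain ⟨hq0, hq1⟩ := hfo_sq_apply_le d
  have h0 : |θ 0 - ((s : ℝ) * (a / 2) + (i : ℝ) * a + (j : ℝ) * (a / 2))| ≤ 1 := by
    rw [← hc0]; exact (sq_le_one_iff_abs_le_one _).1 (hq0.trans hsq)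
  have h1 : |θ 1 - ((s : ℝ) * (a * √3 / 6) + (j : ℝ) * (a * √3 / 2))| ≤ 1 := by
    rw [← hc1]; exact (sq_le_one_iff_abs_le_one _).1 (hq1.trans hsq)
  have hs' : (s : ℝ) = 1 ∨ (s : ℝ) = -1 := by rcases hs with h | h <;> simp [h]
  have ht1 : (1 : ℝ) ≤ √3 := Real.one_le_sqrt.2 (by norm_num)
  have ht3 : √3 ≤ (3 : ℝ) := by nlinarith [Real.sq_sqrt (show (0 : ℝ) ≤ 3 by norm_num), Real.sqrt_nonneg 3]
  have hj := hfo_coeff_j ha ht1 ht3 hs' h1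
  have hi := hfo_coeff_i ha hs' h0
  have h0n := abs_nonneg (θ 0)
  have h1n := abs_nonneg (θ 1)
  have key : ∀ k : ℤ, |(k : ℝ)| * a ≤ 2 * (1 + |θ 0| + |θ 1|) + a →
      |k| ≤ ⌈2 * (1 + |θ 0| + |θ 1|) / a⌉ + 1 := by
    intro k hk
    have hM : 2 * (1 + |θ 0| + |θ 1|) / a ≤ (⌈2 * (1 + |θ 0| + |θ 1|) / a⌉ : ℝ) := Int.le_ceil _
    have h' : |(k : ℝ)| ≤ 2 * (1 + |θ 0| + |θ 1|) / a + 1 := by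
      rw [div_add_one ha.ne', le_div_iff₀ ha]; linarith
    have h'' : ((|k| : ℤ) : ℝ) ≤ ((⌈2 * (1 + |θ 0| + |θ 1|) / a⌉ + 1 : ℤ) : ℝ) := by
      rw [Int.cast_abs]; push_cast; linarith
    exact_mod_cast h''
  exact ⟨key i (by linarith), key j (by linarith)⟩

/-! ## The stub -/

/-- **Stub HC helper `hc_farOfNotHollow`** (the two hollow classes are uniformly discrete): for `a > 0` and a
horizontal `θ` which is not of the form `s b + i v₁ + j v₂` (`s = ±1`, `i, j ∈ ℤ`, `b = barlowOffset a`), there is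
`η > 0` with `2η ≤ ‖θ - (s b + i v₁ + j v₂)‖` for all such `s, i, j`: the class points within distance `1` of `θ` are
finitely many (`hfo_box`), each at positive distance. [folklore] -/
theorem hc_farOfNotHollow : ∀ a : ℝ, 0 < a → ∀ θ : EuclideanSpace ℝ (Fin 3), θ 2 = 0 →
    (¬ ∃ s i j : ℤ, (s = 1 ∨ s = -1) ∧
      θ = (s : ℝ) • barlowOffset a + (i : ℝ) • triangularVec₁ a + (j : ℝ) • triangularVec₂ a) →
    ∃ η : ℝ, 0 < η ∧ ∀ s i j : ℤ, s = 1 ∨ s = -1 →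
      2 * η ≤ ‖θ - ((s : ℝ) • barlowOffset a + (i : ℝ) • triangularVec₁ a + (j : ℝ) • triangularVec₂ a)‖ := by
  intro a ha θ _hθ hnot
  set N : ℤ := ⌈2 * (1 + |θ 0| + |θ 1|) / a⌉ + 1
  obtain ⟨η, hη, hfar⟩ := hfo_exists_sep {x : ℤ × ℤ × ℤ | x.1 = 1 ∨ x.1 = -1}
    (fun x => ‖θ - ((x.1 : ℝ) • barlowOffset a + (x.2.1 : ℝ) • triangularVec₁ a +
      (x.2.2 : ℝ) • triangularVec₂ a)‖)
    (fun x hx => norm_pos_iff.2 (sub_ne_zero.2 fun h => hnot ⟨x.1, x.2.1, x.2.2, hx, h⟩))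
    (((Set.finite_Icc (-1 : ℤ) 1).prod ((Set.finite_Icc (-N) N).prod (Set.finite_Icc (-N) N))).subset
      (by
        rintro x ⟨hx, hle⟩
        obtain ⟨hi, hj⟩ := hfo_box ha θ hx hle
        simp only [Set.mem_prod, Set.mem_Icc]
        refine ⟨?_, abs_le.1 hi, abs_le.1 hj⟩
        rcases hx with h | h <;> rw [h] <;> norm_num))
  exact ⟨η, hη, fun s i j hs => hfar (s, i, j) hs⟩

end Summit.AtomisticToContinuum.Crystallization.Theorems.PeriodicWindowsDenseLaminarHull

end
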